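import Literature.Probability.FitznerVanDerHofstad2017.NobleNSumSlices
import HarnessLib

/-!
# [FvdH17] Prop. 5.5 (5.35)–(5.36), Prop. 5.6 (5.38)–(5.41): the `N`-slices of the six weighted cell-42 tables in block coordinates — PROVED

Source: R. Fitzner, R. van der Hofstad, *Mean-field behavior for nearest-neighbor percolation in `d > 10`*,
Electron. J. Probab. **22** (2017) no. 43 [FvdH17], arXiv:1506.07977v2 p. 53; notebook `Percolation.nb` [FvdHnb]
cell 42 (transcript HOME/b2b-lace-num3/published/Percolation.txt l.1161–1170), typed as the tables `Stage1Tails.Tail.*`.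

For each of the six WEIGHTED tables `l` of cell 42 this module computes the `j`-th `N`-slice
`NobleNSums.totalSlice I l j` (module `NobleNSumSlices`) as an explicit polynomial in the block products
`bprod u B i M B̄ j w = uᵀ Bⁱ M B̄ʲ w` over abstract ingredients `I : Stage1Tails.Ingr n` — i.e. the right-hand
side that a per-`N` bound has to reach so that `NobleNSums.NSumLE_of_sliceBounds` turns the family of per-`N`
bounds into the `NSumLE` field of [NoBLE17] Assumption 4.3 with the cell-42 symbol as the constant.  With
`N = 2j + 4` (even tables) resp. `N = 2j + 5` (odd tables) the results read (sums over `a + b = k` written `Σ_{a+b=k}`):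
* `totalSlice_xiEvenDelta` = (5.35) at `N`:  `(N+2)[h⃗^S(A^ι)ᵀ B̄^{N−1} P⃗^E + P⃗^S B^{N−1}(H^{(3)}P⃗^E + A^ι h⃗^E)]`
  `+ (N+2) Σ_{a+b=N/2−1} P⃗^S B^{2a} C^{(1)} B̄^{2b} P⃗^E + (N+2) Σ_{a+b=N/2−2} P⃗^S B^{2a+1} C^{(2)} B̄^{2b+1} P⃗^E`
  (the print's `Σ_{M=0}^{N/2−1} P⃗^S B^{2M}(C^{(1)}B̄ + 1_{M≠N/2−1} B C^{(2)}) B̄^{N−3−2M} P⃗^E` with `M = a` and the bracket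
  distributed) — LITERAL agreement;
* `totalSlice_xiOddDelta` = (5.36) at `N` with the bracket `(H^{(3)}P⃗^E + A^ι h⃗^E)` where the print has `H^{(2)}`
  (the cell uses `Matrix[H3,s]`, transcript l.1163) — otherwise literal;
* `totalSlice_xiIotaEvenDeltaEi` = (5.38) at `N` — LITERAL agreement;
* `totalSlice_xiIotaOddDeltaEi` = (5.40) at `N` except that the cell's `C^{(1)}`-terms carry `B̄^{N−5−2M}` where the
  print has `B̄^{N−4−2M}` (transcript l.1167: no `ē_j` factor on the `C1` line);
* `totalSlice_xiIotaEvenDeltaZero` = (5.39) at `N` with the cell's coefficients `2N−2` (on `P⃗^ι B^{N−1} Ā P⃗^E`) and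
  `N+4` (on the `C`-sum) where the print has `N+2` twice (cell ≥ print termwise);
* `totalSlice_xiIotaOddDeltaZero` = the cell's odd analogue: coefficient `(5N−11)/2` on `P⃗^ι B^{N−1} Ā P⃗^E` (print
  (5.41): `N+2`), middle terms in the `ι`-pattern of (5.38)–(5.40) (`B^{2M+1}C^{(2)}…`, `B^{2M+2}C^{(1)}…`, the latter
  again with `B̄^{N−5−2M}`) where (5.41) prints the plain-`Ξ` pattern `B^{2M}(C^{(1)}B̄ + BC^{(2)})B̄^{N−3−2M}`.
These print-vs-cell differences are RECORDED, not adjudicated (programme file DIVERGENCE.md, entry D72 (lean1-g14)); every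
theorem below states what the CELL's table is, slice by slice, and is reading-agnostic.

Also: the dictionary `slice_kDelta_kOne` … `slice_kLin_kOne` between the kinds of `Stage1Tails` and block
coordinates, and `sum_antidiagonal_symm` (`Σ_{a+b=k}[(a+1)+(b+1)]T = (k+2)Σ_{a+b=k}T`, the identity behind every
`(N+2)` / `(N+1)` of the displays).  Nothing is cited as a hypothesis; no dimension; no numeral of the notebooks.

## References
* [FvdH17] arXiv:1506.07977v2: Prop. 5.5 (5.35)–(5.36), Prop. 5.6 (5.38)–(5.41) (p. 53); Remark 2.3 (pp. 12–13).
* [FvdHnb] `Percolation.nb` cell 42 (transcript l.1161–1170).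
* [NoBLE17] PTRF 169 (2017): Assumption 4.3 (4.32)–(4.33) (p. 1086).
-/

noncomputable section

namespace Literature.Probability.FitznerVanDerHofstad2017.NobleNSums

open Finset
open Literature.Probability.LatticeModels Literature.Probability.Percolation
open Literature.Probability.FitznerVanDerHofstad2017 Stage1Tails EigenTails
open scoped BigOperators Matrix

variable {n : Type*} [Fintype n] [DecidableEq n]

/-! ## Block coordinates -/

section Blocks

/-- The block product `uᵀ Bⁱ M B̄ʲ w` of the displays of [FvdH17] §5 (e.g. `P⃗^S (B^ι)^{2M} C^{(1)} (B̄^ι)^{N−2−2M} P⃗^E`).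
[cite: FitznerVanDerHofstad2017, Prop. 5.5 (5.34)–(5.36), Prop. 5.6 (5.37)–(5.41) (arXiv:1506.07977v2 pp. 52–53)] -/
def bprod (u : n → ℝ) (B : Matrix n n ℝ) (i : ℕ) (M : Matrix n n ℝ) (Bb : Matrix n n ℝ) (j : ℕ) (w : n → ℝ) : ℝ :=
  u ⬝ᵥ ((B ^ i * M * Bb ^ j) *ᵥ w)

/-- `EigenTails.tailTerm φ … = φ · bprod …`. [folklore] -/
theorem tailTerm_eq_mul_bprod (φ : ℝ) (u : n → ℝ) (B : Matrix n n ℝ) (i : ℕ) (M : Matrix n n ℝ)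
    (Bb : Matrix n n ℝ) (j : ℕ) (w : n → ℝ) : tailTerm φ u B i M Bb j w = φ * bprod u B i M Bb j w := rfl

/-- the `(a,b)` term of (⋆) in block coordinates: `uᵀ B^{2a+α} M B̄^{2b+β} w`. [folklore] -/
theorem term_eq_bprod (u : n → ℝ) (B : Matrix n n ℝ) (α : ℕ) (M : Matrix n n ℝ) (Bb : Matrix n n ℝ) (β : ℕ)
    (w : n → ℝ) (p : ℕ × ℕ) : term u B α M Bb β w p = bprod u B (2 * p.1 + α) M Bb (2 * p.2 + β) w := by
  rw [Nat.add_comm (2 * p.1) α]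
  simp only [term, bprod, pow_add, pow_mul, sq, Matrix.mul_assoc]

/-- block products of non-negative ingredients are `≥ 0`. [folklore] -/
theorem bprod_nonneg {u : n → ℝ} {B M Bb : Matrix n n ℝ} {w : n → ℝ} (h : NN u B M Bb w) (i j : ℕ) :
    0 ≤ bprod u B i M Bb j w := by
  have := tailTerm_nonneg zero_le_one h.u h.B h.M h.Bb h.w i j (φ := 1) (u := u) (B := B) (M := M) (Bb := Bb) (w := w)
  simpa [tailTerm_eq_mul_bprod] using this

variable (u : n → ℝ) (B : Matrix n n ℝ) (α : ℕ) (M : Matrix n n ℝ) (Bb : Matrix n n ℝ) (β : ℕ) (w : n → ℝ)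

/-- `(delta, one)` slice: `uᵀ B^α M B̄^{2k+β} w`. [folklore] -/
theorem slice_kDelta_kOne (k : ℕ) : slice kDelta kOne u B α M Bb β w k = bprod u B α M Bb (2 * k + β) w := by
  rw [slice_kDelta_left]
  simp only [kOne, one_mul, bprod, pow_add, pow_mul, sq, Matrix.mul_assoc]

/-- `(delta, lin)` slice: `(k+1) · uᵀ B^α M B̄^{2k+β} w`. [folklore] -/
theorem slice_kDelta_kLin (k : ℕ) :
    slice kDelta kLin u B α M Bb β w k = ((k : ℝ) + 1) * bprod u B α M Bb (2 * k + β) w := by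
  rw [slice_kDelta_left]
  simp only [kLin, bprod, pow_add, pow_mul, sq, Matrix.mul_assoc]

/-- `(one, delta)` slice: `uᵀ B^{2k+α} M B̄^β w`. [folklore] -/
theorem slice_kOne_kDelta (k : ℕ) : slice kOne kDelta u B α M Bb β w k = bprod u B (2 * k + α) M Bb β w := by
  rw [slice_kDelta_right, Nat.add_comm (2 * k) α]
  simp only [kOne, one_mul, bprod, pow_add, pow_mul, sq, Matrix.mul_assoc]

/-- `(lin, delta)` slice: `(k+1) · uᵀ B^{2k+α} M B̄^β w`. [folklore] -/
theorem slice_kLin_kDelta (k : ℕ) :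
    slice kLin kDelta u B α M Bb β w k = ((k : ℝ) + 1) * bprod u B (2 * k + α) M Bb β w := by
  rw [slice_kDelta_right, Nat.add_comm (2 * k) α]
  simp only [kLin, bprod, pow_add, pow_mul, sq, Matrix.mul_assoc]

/-- `(one, one)` slice: `Σ_{a+b=k} uᵀ B^{2a+α} M B̄^{2b+β} w`. [folklore] -/
theorem slice_kOne_kOne (k : ℕ) :
    slice kOne kOne u B α M Bb β w k = ∑ p ∈ antidiagonal k, bprod u B (2 * p.1 + α) M Bb (2 * p.2 + β) w := by
  simp only [slice, kOne, one_mul, term_eq_bprod]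

/-- `(one, lin)` slice: `Σ_{a+b=k} (b+1) uᵀ B^{2a+α} M B̄^{2b+β} w`. [folklore] -/
theorem slice_kOne_kLin (k : ℕ) : slice kOne kLin u B α M Bb β w k
    = ∑ p ∈ antidiagonal k, ((p.2 : ℝ) + 1) * bprod u B (2 * p.1 + α) M Bb (2 * p.2 + β) w := by
  simp only [slice, kOne, kLin, one_mul, term_eq_bprod]

/-- `(lin, one)` slice: `Σ_{a+b=k} (a+1) uᵀ B^{2a+α} M B̄^{2b+β} w`. [folklore] -/
theorem slice_kLin_kOne (k : ℕ) : slice kLin kOne u B α M Bb β w k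
    = ∑ p ∈ antidiagonal k, ((p.1 : ℝ) + 1) * bprod u B (2 * p.1 + α) M Bb (2 * p.2 + β) w := by
  simp only [slice, kOne, kLin, mul_one, term_eq_bprod]

/-- **the symmetrisation behind every `(N+2)` / `(N+1)`**: `Σ_{a+b=k} [(a+1) + (b+1)] T(a,b) = (k+2) Σ_{a+b=k} T(a,b)`.
[folklore] -/
theorem sum_antidiagonal_symm (k : ℕ) (T : ℕ × ℕ → ℝ) :
    ∑ p ∈ antidiagonal k, ((p.1 : ℝ) + 1) * T p + ∑ p ∈ antidiagonal k, ((p.2 : ℝ) + 1) * T p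
      = ((k : ℝ) + 2) * ∑ p ∈ antidiagonal k, T p := by
  rw [← Finset.sum_add_distrib, Finset.mul_sum]
  refine Finset.sum_congr rfl fun p hp => ?_
  have hk : (k : ℝ) = p.1 + p.2 := by exact_mod_cast (mem_antidiagonal.1 hp).symm
  rw [hk]; ring

end Blocks

/-- a piece's slice on a constructor (unfolding lemma). [folklore] -/
@[simp] theorem pieceSlice_mk (I : Ingr n) (c : ℕ) (drop : Bool) (ψ χ : Kind) (a : USym) (α : ℕ) (b : MSym)
    (β : ℕ) (e : WSym) (j : ℕ) : pieceSlice I ⟨c, drop, ψ, χ, a, α, b, β, e⟩ j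
      = (c : ℝ) * slice ψ.c χ.c (I.u a) I.B α (I.m b) I.Bb β (I.w e) (j + if drop then 1 else 0) := rfl

/-! ## The six weighted tables, slice by slice -/

section TablesXi

variable (I : Ingr n) (j : ℕ)

/-- **(5.35) at `N = 2j+4`** = the `j`-th slice of `Tail.xiEvenDelta` (`Bound[Xi,EvenTail,Delta,s] − Bound[Xi,2,Delta,s]`):
`(N+2) h⃗^S(A^ι)ᵀ B̄^{N−1} P⃗^E + (N+2) P⃗^S B^{N−1}(H^{(3)}P⃗^E + A^ι h⃗^E) + (N+2) Σ_{a+b=j+1} P⃗^S B^{2a} C^{(1)} B̄^{2b} P⃗^E`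
`+ (N+2) Σ_{a+b=j} P⃗^S B^{2a+1} C^{(2)} B̄^{2b+1} P⃗^E` — literal agreement with the print.
[cite: FitznerVanDerHofstad2017, Prop. 5.5 (5.35) (arXiv:1506.07977v2 p. 53); notebook Percolation.nb cell 42 (transcript l.1161)] -/
theorem totalSlice_xiEvenDelta : totalSlice I Tail.xiEvenDelta j
    = (2 * (j : ℝ) + 6) * bprod (I.u .hSAtNR) I.B 0 (I.m .one) I.Bb (2 * j + 3) (I.w .PE)
      + (2 * (j : ℝ) + 6) * bprod (I.u .PS) I.B (2 * j + 3) (I.m .one) I.Bb 0 (I.w .H3PEAhE)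
      + (2 * (j : ℝ) + 6) * ∑ p ∈ antidiagonal (j + 1), bprod (I.u .PS) I.B (2 * p.1) (I.m .C1) I.Bb (2 * p.2) (I.w .PE)
      + (2 * (j : ℝ) + 6)
        * ∑ p ∈ antidiagonal j, bprod (I.u .PS) I.B (2 * p.1 + 1) (I.m .C2) I.Bb (2 * p.2 + 1) (I.w .PE) := by
  have h5 := sum_antidiagonal_symm (j + 1)
    (fun p => bprod (I.u .PS) I.B (2 * p.1) (I.m .C1) I.Bb (2 * p.2) (I.w .PE))
  have h7 := sum_antidiagonal_symm j
    (fun p => bprod (I.u .PS) I.B (2 * p.1 + 1) (I.m .C2) I.Bb (2 * p.2 + 1) (I.w .PE))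
  push_cast at h5
  simp only [Tail.xiEvenDelta, totalSlice_cons, totalSlice_nil, pieceSlice_mk, Kind.c, Bool.false_eq_true,
    if_false, if_true, add_zero, Nat.cast_ofNat, slice_kDelta_kLin, slice_kDelta_kOne, slice_kLin_kDelta,
    slice_kOne_kDelta, slice_kOne_kLin, slice_kLin_kOne, slice_kOne_kOne]
  linear_combination 2 * h5 + 2 * h7

/-- **(5.36) at `N = 2j+5`** (bracket with the cell's `H^{(3)}`; the print has `H^{(2)}` — recorded, not adjudicated)
= the `j`-th slice of `Tail.xiOddDelta` (`Bound[Xi,OddTail,Delta,s] − Bound[Xi,3,Delta,s]`):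
`(N+2) h⃗^S(A^ι)ᵀ B̄^{N−1} P⃗^E + (N+2) P⃗^S B^{N−1}(H^{(3)}P⃗^E + A^ι h⃗^E) + (N+2) Σ_{a+b=j+1} P⃗^S B^{2a}(C^{(1)}B̄ + BC^{(2)})B̄^{2b} P⃗^E`.
[cite: FitznerVanDerHofstad2017, Prop. 5.5 (5.36) (arXiv:1506.07977v2 p. 53); notebook Percolation.nb cell 42 (transcript l.1163–1164)] -/
theorem totalSlice_xiOddDelta : totalSlice I Tail.xiOddDelta j
    = (2 * (j : ℝ) + 7) * bprod (I.u .hSAtNR) I.B 0 (I.m .one) I.Bb (2 * j + 4) (I.w .PE)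
      + (2 * (j : ℝ) + 7) * bprod (I.u .PS) I.B (2 * j + 4) (I.m .one) I.Bb 0 (I.w .H3PEAhE)
      + (2 * (j : ℝ) + 7)
        * ∑ p ∈ antidiagonal (j + 1), bprod (I.u .PS) I.B (2 * p.1) (I.m .C1BbBC2) I.Bb (2 * p.2) (I.w .PE) := by
  have h5 := sum_antidiagonal_symm (j + 1)
    (fun p => bprod (I.u .PS) I.B (2 * p.1) (I.m .C1BbBC2) I.Bb (2 * p.2) (I.w .PE))
  push_cast at h5
  simp only [Tail.xiOddDelta, totalSlice_cons, totalSlice_nil, pieceSlice_mk, Kind.c, Bool.false_eq_true,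
    if_false, if_true, add_zero, Nat.cast_ofNat, Nat.cast_one, slice_kDelta_kLin, slice_kDelta_kOne,
    slice_kLin_kDelta, slice_kOne_kDelta, slice_kOne_kLin, slice_kLin_kOne, slice_kOne_kOne]
  linear_combination 2 * h5

end TablesXi

section TablesXiIota

variable (I : Ingr n) (j : ℕ)

/-- **(5.38) at `N = 2j+4`** = the `j`-th slice of `Tail.xiIotaEvenDeltaEi` (`Bound[XiIota,EvenTail,Delta,ei,s] − Bound[XiIota,2,Delta,ei,s]`):
`(N+1) h⃗^{ι,II} B̄^{N−1} P⃗^E + (N+1) P⃗^ι B^{N−1}(H^{(3)}P⃗^E + A^ι h⃗^E) + (N+1) Σ_{a+b=j} P⃗^ι B^{2a+1}(C^{(2)}B̄ + BC^{(1)})B̄^{2b} P⃗^E`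
— literal agreement with the print (`M = a`, `N−4−2M = 2b`).
[cite: FitznerVanDerHofstad2017, Prop. 5.6 (5.38) (arXiv:1506.07977v2 p. 53); notebook Percolation.nb cell 42 (transcript l.1166)] -/
theorem totalSlice_xiIotaEvenDeltaEi : totalSlice I Tail.xiIotaEvenDeltaEi j
    = (2 * (j : ℝ) + 5) * bprod (I.u .hII) I.B 0 (I.m .one) I.Bb (2 * j + 3) (I.w .PE)
      + (2 * (j : ℝ) + 5) * bprod (I.u .Piota) I.B (2 * j + 3) (I.m .one) I.Bb 0 (I.w .H3PEAhE)
      + (2 * (j : ℝ) + 5)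
        * ∑ p ∈ antidiagonal j, bprod (I.u .Piota) I.B (2 * p.1 + 1) (I.m .C2BbBC1) I.Bb (2 * p.2) (I.w .PE) := by
  have h5 := sum_antidiagonal_symm j
    (fun p => bprod (I.u .Piota) I.B (2 * p.1 + 1) (I.m .C2BbBC1) I.Bb (2 * p.2) (I.w .PE))
  simp only [Tail.xiIotaEvenDeltaEi, totalSlice_cons, totalSlice_nil, pieceSlice_mk, Kind.c, Bool.false_eq_true,
    if_false, add_zero, Nat.cast_ofNat, Nat.cast_one, slice_kDelta_kLin, slice_kDelta_kOne,
    slice_kLin_kDelta, slice_kOne_kDelta, slice_kOne_kLin, slice_kLin_kOne, slice_kOne_kOne]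
  linear_combination 2 * h5

/-- **(5.40) at `N = 2j+5`, as the cell has it** = the `j`-th slice of `Tail.xiIotaOddDeltaEi`
(`Bound[XiIota,OddTail,Delta,ei,s] − Bound[XiIota,3,Delta,ei,s]`):
`(N+1) h⃗^{ι,II} B̄^{N−1} P⃗^E + (N+1) P⃗^ι B^{N−1}(H^{(2)}P⃗^E + A^ι h⃗^E) + (N+1) Σ_{a+b=j+1} P⃗^ι B^{2a+1} C^{(2)} B̄^{2b} P⃗^E`
`+ (N+1) Σ_{a+b=j} P⃗^ι B^{2a+2} C^{(1)} B̄^{2b} P⃗^E` — the print's last sum has `B̄^{N−4−2M} = B̄^{2b+1}` (recorded, not adjudicated).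
[cite: FitznerVanDerHofstad2017, Prop. 5.6 (5.40) (arXiv:1506.07977v2 p. 53); notebook Percolation.nb cell 42 (transcript l.1167)] -/
theorem totalSlice_xiIotaOddDeltaEi : totalSlice I Tail.xiIotaOddDeltaEi j
    = (2 * (j : ℝ) + 6) * bprod (I.u .hII) I.B 0 (I.m .one) I.Bb (2 * j + 4) (I.w .PE)
      + (2 * (j : ℝ) + 6) * bprod (I.u .Piota) I.B (2 * j + 4) (I.m .one) I.Bb 0 (I.w .H2PEAhE)
      + (2 * (j : ℝ) + 6)
        * ∑ p ∈ antidiagonal (j + 1), bprod (I.u .Piota) I.B (2 * p.1 + 1) (I.m .C2) I.Bb (2 * p.2) (I.w .PE)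
      + (2 * (j : ℝ) + 6)
        * ∑ p ∈ antidiagonal j, bprod (I.u .Piota) I.B (2 * p.1 + 2) (I.m .C1) I.Bb (2 * p.2) (I.w .PE) := by
  have h5 := sum_antidiagonal_symm (j + 1)
    (fun p => bprod (I.u .Piota) I.B (2 * p.1 + 1) (I.m .C2) I.Bb (2 * p.2) (I.w .PE))
  have h7 := sum_antidiagonal_symm j
    (fun p => bprod (I.u .Piota) I.B (2 * p.1 + 2) (I.m .C1) I.Bb (2 * p.2) (I.w .PE))
  push_cast at h5
  simp only [Tail.xiIotaOddDeltaEi, totalSlice_cons, totalSlice_nil, pieceSlice_mk, Kind.c, Bool.false_eq_true,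
    if_false, if_true, add_zero, Nat.cast_ofNat, slice_kDelta_kLin, slice_kDelta_kOne, slice_kLin_kDelta,
    slice_kOne_kDelta, slice_kOne_kLin, slice_kLin_kOne, slice_kOne_kOne]
  linear_combination 2 * h5 + 2 * h7

/-- **(5.39) at `N = 2j+4`, as the cell has it** = the `j`-th slice of `Tail.xiIotaEvenDeltaZero`
(`Bound[XiIota,EvenTail,Delta,0,s] − Bound[XiIota,2,Delta,0,s]`):
`(2N−2) P⃗^ι B^{N−1} Ā P⃗^E + (N+2) h⃗^{ι,II} B̄^{N−1} P⃗^E + (N+2) P⃗^ι B^{N−1}(H^{(3)}P⃗^E + A^ι h⃗^E)`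
`+ (N+4) Σ_{a+b=j} P⃗^ι B^{2a+1}(C^{(2)}B̄ + BC^{(1)})B̄^{2b} P⃗^E` — the print has `N+2` in place of `2N−2` and of `N+4`
(cell ≥ print termwise; recorded, not adjudicated).
[cite: FitznerVanDerHofstad2017, Prop. 5.6 (5.39) (arXiv:1506.07977v2 p. 53); notebook Percolation.nb cell 42 (transcript l.1169)] -/
theorem totalSlice_xiIotaEvenDeltaZero : totalSlice I Tail.xiIotaEvenDeltaZero j
    = (4 * (j : ℝ) + 6) * bprod (I.u .Piota) I.B (2 * j + 3) (I.m .AbarNR) I.Bb 0 (I.w .PE)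
      + (2 * (j : ℝ) + 6) * bprod (I.u .hII) I.B 0 (I.m .one) I.Bb (2 * j + 3) (I.w .PE)
      + (2 * (j : ℝ) + 6) * bprod (I.u .Piota) I.B (2 * j + 3) (I.m .one) I.Bb 0 (I.w .H3PEAhE)
      + (2 * (j : ℝ) + 8)
        * ∑ p ∈ antidiagonal j, bprod (I.u .Piota) I.B (2 * p.1 + 1) (I.m .C2BbBC1) I.Bb (2 * p.2) (I.w .PE) := by
  have h5 := sum_antidiagonal_symm j
    (fun p => bprod (I.u .Piota) I.B (2 * p.1 + 1) (I.m .C2BbBC1) I.Bb (2 * p.2) (I.w .PE))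
  simp only [Tail.xiIotaEvenDeltaZero, totalSlice_cons, totalSlice_nil, pieceSlice_mk, Kind.c, Bool.false_eq_true,
    if_false, add_zero, Nat.cast_ofNat, slice_kDelta_kLin, slice_kDelta_kOne, slice_kLin_kDelta,
    slice_kOne_kDelta, slice_kOne_kLin, slice_kLin_kOne, slice_kOne_kOne]
  linear_combination 2 * h5

/-- **the cell's odd analogue of (5.39) at `N = 2j+5`** = the `j`-th slice of `Tail.xiIotaOddDeltaZero`
(`Bound[XiIota,OddTail,Delta,0,s] − Bound[XiIota,3,Delta,0,s]`):
`(5j+7) P⃗^ι B^{N−1} Ā P⃗^E + (N+2) h⃗^{ι,II} B̄^{N−1} P⃗^E + (N+2) P⃗^ι B^{N−1}(H^{(2)}P⃗^E + A^ι h⃗^E)`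
`+ (N+2) Σ_{a+b=j+1} P⃗^ι B^{2a+1} C^{(2)} B̄^{2b} P⃗^E + (N+2) Σ_{a+b=j} P⃗^ι B^{2a+2} C^{(1)} B̄^{2b} P⃗^E`;
the print (5.41) has `N+2` on the `Ā` term and the plain-`Ξ` middle pattern `Σ_M P⃗^ι B^{2M}(C^{(1)}B̄ + BC^{(2)})B̄^{N−3−2M}P⃗^E`
(recorded, not adjudicated).
[cite: FitznerVanDerHofstad2017, Prop. 5.6 (5.41) (arXiv:1506.07977v2 p. 53); notebook Percolation.nb cell 42 (transcript l.1170)] -/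
theorem totalSlice_xiIotaOddDeltaZero : totalSlice I Tail.xiIotaOddDeltaZero j
    = (5 * (j : ℝ) + 7) * bprod (I.u .Piota) I.B (2 * j + 4) (I.m .AbarNR) I.Bb 0 (I.w .PE)
      + (2 * (j : ℝ) + 7) * bprod (I.u .hII) I.B 0 (I.m .one) I.Bb (2 * j + 4) (I.w .PE)
      + (2 * (j : ℝ) + 7) * bprod (I.u .Piota) I.B (2 * j + 4) (I.m .one) I.Bb 0 (I.w .H2PEAhE)
      + (2 * (j : ℝ) + 7)
        * ∑ p ∈ antidiagonal (j + 1), bprod (I.u .Piota) I.B (2 * p.1 + 1) (I.m .C2) I.Bb (2 * p.2) (I.w .PE)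
      + (2 * (j : ℝ) + 7)
        * ∑ p ∈ antidiagonal j, bprod (I.u .Piota) I.B (2 * p.1 + 2) (I.m .C1) I.Bb (2 * p.2) (I.w .PE) := by
  have h5 := sum_antidiagonal_symm (j + 1)
    (fun p => bprod (I.u .Piota) I.B (2 * p.1 + 1) (I.m .C2) I.Bb (2 * p.2) (I.w .PE))
  have h7 := sum_antidiagonal_symm j
    (fun p => bprod (I.u .Piota) I.B (2 * p.1 + 2) (I.m .C1) I.Bb (2 * p.2) (I.w .PE))
  push_cast at h5
  simp only [Tail.xiIotaOddDeltaZero, totalSlice_cons, totalSlice_nil, pieceSlice_mk, Kind.c, Bool.false_eq_true,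
    if_false, if_true, add_zero, Nat.cast_ofNat, Nat.cast_one, slice_kDelta_kLin, slice_kDelta_kOne,
    slice_kLin_kDelta, slice_kOne_kDelta, slice_kOne_kLin, slice_kLin_kOne, slice_kOne_kOne]
  linear_combination 2 * h5 + 2 * h7

end TablesXiIota

end Literature.Probability.FitznerVanDerHofstad2017.NobleNSums

end
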